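import Mathlib
import Summits.PneNP.PneNP.Theorems.PstarPDT
import Summits.PneNP.PneNP.Theorems.PstarSALevel
import Summits.PneNP.PneNP.Theorems.PstarGapLemma
import Summits.PneNP.PneNP.Theorems.PstarGapPeeling
import Summits.PneNP.PneNP.Theorems.PstarGapOneKills
import Summits.PneNP.PneNP.Theorems.PstarGapFreeVar

/-!
# De-pinning: an output with a pinned AND slot is a parity constraint (ROUND-24, towards item T24.21)

FRONTIER range-avoidance ladder, rung F-N3, ROUND 24 (cell `pnp-ideate`, gap-lemma programme `PstarGapLemma`; restricted-model
proof complexity — nothing here bears on `P` versus `NP`).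

The planner's next rung T24.21 (memo ROUND-24-PRESEED §13 R10(z′)/(z), STATUS 2026-08-28T07:28Z) concerns minimal infeasible sets
under `h` UNIT PINS `a_v = c` plus one tip-reading constraint.  This file records the reduction that removes the pinned OUTPUTS: on a
pure `P⋆` instance, if the parity system `W` contains the pin `({v}, c)` and `v = vars g s` is an AND slot of the output `g ∈ J`,
then on every assignment satisfying `W` the equation of `g` reads

* `x_u ⊕ x_w = y_g` if `c = false` (the product is killed), and
* `x_u ⊕ x_w ⊕ a_q = y_g` if `c = true` (the product is activated; `q = vars g t` the other AND slot),

i.e. it IS the parity constraint `linPin I y g t c` (`eval_eq_iff_linPin`).  Hence `J` is minimal `W`-infeasible iff... in the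
direction we need: `J ∖ {g}` is minimal infeasible under `W ∪ {linPin I y g t c}` (`minInfeasible_linPin`): one output fewer, one
constraint (of at most three variables, `card_linPin_le`) more.  Iterating over the set `T` of outputs of `J` with a pinned AND slot
(`depin`): `J ∖ T` is minimal infeasible under a system `W' ⊇ W` with `#W' ≤ #W + #T` whose new constraints all have at most three
variables; under `MaxDegree Δ` and `h` pins, `#T ≤ Δ·h`.  Afterwards no output of `J ∖ T` has a pinned AND slot, so (when pins avoid
XOR slots) every pin is a constraint at a variable read by no remaining output and can be discarded by
`PstarGapFreeVar.minInfeasible_elimW`.  So T24.21 is equivalent, up to `+Δ·h` outputs, to a PIN-FREE gap statement for "one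
tip-reading constraint + `s ≤ Δ·h` XOR-edge parities of non-members".

Declared here: `linPin`, `parity_linPin`, `card_linPin_le`, `eval_eq_iff_linPin`, `minInfeasible_linPin`, `depin`.
-/

set_option linter.dupNamespace false -- `Summit.PneNP.PneNP.…`: summit = sub-problem name (D-0017 single-conjunct layout)

open Finset Literature.Computability.Complexity
open scoped symmDiff
open Summit.PneNP.PneNP.Theorems.PstarPDT (parity parity_singleton)
open Summit.PneNP.PneNP.Theorems.PstarSALevel (varSet bdry)
open Summit.PneNP.PneNP.Theorems.PstarGapLemma (Sat Feasible MinInfeasible)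
open Summit.PneNP.PneNP.Theorems.PstarGapPeeling (eval_pure)
open Summit.PneNP.PneNP.Theorems.PstarGapOneKills (ge2_pair)
open Summit.PneNP.PneNP.Theorems.PstarGapFreeVar (parity_symmDiff)

namespace Summit.PneNP.PneNP.Theorems.PstarDepin

variable {n m : ℕ}

/-- The linearisation of output `g` when one AND slot is pinned to `c` and `t` is the OTHER AND slot: the parity constraint
`x_{vars g 0} ⊕ x_{vars g 1} (⊕ a_{vars g t} if c) = y g`, written with symmetric differences of singletons so that no distinctness of
the variables is needed. -/
def linPin (I : LocalMap 4 n m) (y : Fin m → Bool) (g : Fin m) (t : Fin 4) (c : Bool) : Finset (Fin n) × Bool :=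
  (if c then ({I.vars g 0} ∆ {I.vars g 1}) ∆ {I.vars g t} else {I.vars g 0} ∆ {I.vars g 1}, y g)

/-- The parity of the linearised constraint. -/
theorem parity_linPin (I : LocalMap 4 n m) (y : Fin m → Bool) (g : Fin m) (t : Fin 4) (c : Bool) (z : Fin n → Bool) :
    parity (linPin I y g t c).1 z = xor (xor (z (I.vars g 0)) (z (I.vars g 1))) (c && z (I.vars g t)) := by
  unfold linPin
  cases c
  · simp only [Bool.false_eq_true, if_false, parity_symmDiff, parity_singleton, Bool.false_and, Bool.xor_false]
  · simp only [if_true, parity_symmDiff, parity_singleton, Bool.true_and]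

/-- The linearised constraint has at most three variables. -/
theorem card_linPin_le (I : LocalMap 4 n m) (y : Fin m → Bool) (g : Fin m) (t : Fin 4) (c : Bool) :
    (linPin I y g t c).1.card ≤ 3 := by
  unfold linPin
  have h2 : (({I.vars g 0} : Finset (Fin n)) ∆ {I.vars g 1}).card ≤ 2 :=
    (card_le_card (symmDiff_subset_union (s := {I.vars g 0}) (t := {I.vars g 1}))).trans
      ((card_union_le _ _).trans (by rw [card_singleton, card_singleton]))
  cases c
  · simp only [Bool.false_eq_true, if_false]
    exact h2.trans (by norm_num)
  · simp only [if_true]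
    exact (card_le_card (symmDiff_subset_union (s := {I.vars g 0} ∆ {I.vars g 1}) (t := {I.vars g t}))).trans
      ((card_union_le _ _).trans (by rw [card_singleton]; omega))

/-- **On assignments satisfying the pin, the output IS its linearisation.**  For a pure instance, AND slots `s ≠ t` of `g` and an
assignment with `z (vars g s) = c`: `I.eval z g = y g ↔` the constraint `linPin I y g t c` holds at `z`. -/
theorem eval_eq_iff_linPin (I : LocalMap 4 n m) (hI : I.IsPure xorAndPred) (y : Fin m → Bool) {g : Fin m} {s t : Fin 4}
    (hs : 2 ≤ s.val) (ht : 2 ≤ t.val) (hst : s ≠ t) {c : Bool} (z : Fin n → Bool) (hz : z (I.vars g s) = c) :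
    I.eval z g = y g ↔ parity (linPin I y g t c).1 z = (linPin I y g t c).2 := by
  rw [parity_linPin, eval_pure I hI z g, show (linPin I y g t c).2 = y g from by unfold linPin; split <;> rfl]
  rcases ge2_pair s t hs ht hst with ⟨rfl, rfl⟩ | ⟨rfl, rfl⟩
  · rw [hz]
  · rw [hz, Bool.and_comm]

/-- **De-pinning one output.**  If `W` pins the AND slot `vars g s` of `g ∈ J` to `c` and `J` is minimal `W`-infeasible, then
`J ∖ {g}` is minimal infeasible under `W ∪ {linPin I y g t c}` (`t` the other AND slot). -/
theorem minInfeasible_linPin (I : LocalMap 4 n m) (hI : I.IsPure xorAndPred) {y : Fin m → Bool}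
    {W : Finset (Finset (Fin n) × Bool)} {J : Finset (Fin m)} (hmin : MinInfeasible I y W J) {g : Fin m} (hg : g ∈ J)
    {s t : Fin 4} (hs : 2 ≤ s.val) (ht : 2 ≤ t.val) (hst : s ≠ t) {c : Bool}
    (hpin : (({I.vars g s} : Finset (Fin n)), c) ∈ W) :
    MinInfeasible I y (insert (linPin I y g t c) W) (J.erase g) := by
  have key : ∀ z : Fin n → Bool, Sat W z → (I.eval z g = y g ↔ parity (linPin I y g t c).1 z = (linPin I y g t c).2) :=
    fun z hz => eval_eq_iff_linPin I hI y hs ht hst z (by have h := hz _ hpin; rwa [parity_singleton] at h)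
  refine ⟨?_, fun j hj => ?_⟩
  · rintro ⟨z, hzW, hzJ⟩
    have hW : Sat W z := fun e he => hzW e (mem_insert_of_mem he)
    have hgz : I.eval z g = y g := (key z hW).2 (hzW _ (mem_insert_self _ _))
    refine hmin.1 ⟨z, hW, fun j hj => ?_⟩
    by_cases h : j = g
    · rw [h]; exact hgz
    · exact hzJ j (mem_erase.2 ⟨h, hj⟩)
  · obtain ⟨hjg, hjJ⟩ := mem_erase.1 hj
    obtain ⟨z, hzW, hzJ⟩ := hmin.2 j hjJ
    refine ⟨z, fun e he => ?_, fun i hi => hzJ i (mem_erase.2 ⟨(mem_erase.1 hi).1, (mem_erase.1 (mem_erase.1 hi).2).2⟩)⟩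
    rcases mem_insert.1 he with rfl | he
    · exact (key z hzW).1 (hzJ g (mem_erase.2 ⟨Ne.symm hjg, hg⟩))
    · exact hzW e he

/-- **De-pinning all pinned outputs.**  Let `V` be a set of variables each pinned by `W` (`({v}, c) ∈ W` for some `c`), and let
`T` be the outputs of `J` with an AND slot in `V`.  If `J` is minimal `W`-infeasible then `J ∖ T` is minimal infeasible under some
`W' ⊇ W` with `#W' ≤ #W + #T`, all of whose new constraints have at most three variables. -/
theorem depin (I : LocalMap 4 n m) (hI : I.IsPure xorAndPred) (y : Fin m → Bool) (V : Finset (Fin n)) :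
    ∀ (J : Finset (Fin m)) (W : Finset (Finset (Fin n) × Bool)), (∀ v ∈ V, ∃ c : Bool, (({v} : Finset (Fin n)), c) ∈ W) →
      MinInfeasible I y W J →
      ∃ W' : Finset (Finset (Fin n) × Bool), W ⊆ W' ∧
        W'.card ≤ W.card + (J.filter fun g => I.vars g 2 ∈ V ∨ I.vars g 3 ∈ V).card ∧
        (∀ e ∈ W', e ∉ W → e.1.card ≤ 3) ∧
        MinInfeasible I y W' (J \ J.filter fun g => I.vars g 2 ∈ V ∨ I.vars g 3 ∈ V) := by
  intro J
  induction J using Finset.strongInduction with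
  | H J ih =>
    intro W hV hmin
    by_cases hT : (J.filter fun g => I.vars g 2 ∈ V ∨ I.vars g 3 ∈ V) = ∅
    · refine ⟨W, Subset.rfl, by omega, fun e he hne => absurd he hne, ?_⟩
      rwa [hT, sdiff_empty]
    · obtain ⟨g, hgT⟩ := nonempty_iff_ne_empty.2 hT
      obtain ⟨hgJ, hgV⟩ := mem_filter.1 hgT
      -- the pinned slot `s` and the other AND slot `t`
      obtain ⟨s, t, hs, ht, hst, hsV⟩ : ∃ s t : Fin 4, 2 ≤ s.val ∧ 2 ≤ t.val ∧ s ≠ t ∧ I.vars g s ∈ V := by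
        rcases hgV with h | h
        · exact ⟨2, 3, by decide, by decide, by decide, h⟩
        · exact ⟨3, 2, by decide, by decide, by decide, h⟩
      obtain ⟨c, hc⟩ := hV _ hsV
      have hmin' := minInfeasible_linPin I hI hmin hgJ hs ht hst hc
      have hsub : J.erase g ⊂ J := erase_ssubset hgJ
      obtain ⟨W', hWW', hcard, hnew, hmin''⟩ :=
        ih (J.erase g) hsub (insert (linPin I y g t c) W) (fun v hv => (hV v hv).imp fun c hc => mem_insert_of_mem hc) hmin'
      have hfilter : (J.erase g).filter (fun g => I.vars g 2 ∈ V ∨ I.vars g 3 ∈ V) =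
          (J.filter fun g => I.vars g 2 ∈ V ∨ I.vars g 3 ∈ V).erase g := filter_erase _ _ _
      have hdiff : J.erase g \ (J.erase g).filter (fun g => I.vars g 2 ∈ V ∨ I.vars g 3 ∈ V) =
          J \ J.filter fun g => I.vars g 2 ∈ V ∨ I.vars g 3 ∈ V := by
        ext j
        simp only [mem_sdiff, mem_erase, mem_filter, ne_eq]
        constructor
        · rintro ⟨⟨hjg, hjJ⟩, h⟩
          exact ⟨hjJ, fun h' => h ⟨⟨hjg, hjJ⟩, h'.2⟩⟩
        · rintro ⟨hjJ, h⟩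
          have hjg : ¬j = g := fun e => h ⟨hjJ, e ▸ hgV⟩
          exact ⟨⟨hjg, hjJ⟩, fun h' => h ⟨hjJ, h'.2⟩⟩
      refine ⟨W', (subset_insert _ _).trans hWW', ?_, fun e he hne => ?_, by rwa [hdiff] at hmin''⟩
      · rw [hfilter, card_erase_of_mem hgT] at hcard
        have := card_insert_le (linPin I y g t c) W
        have hpos := card_pos.2 ⟨g, hgT⟩
        omega
      · by_cases h : e = linPin I y g t c
        · rw [h]; exact card_linPin_le I y g t c
        · exact hnew e he (fun h' => (mem_insert.1 h').elim h hne)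

end Summit.PneNP.PneNP.Theorems.PstarDepin
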